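import Mathlib
import Summits.CriticalPhenomena.CardyFormulaZ2.Theorems.CardySelfRefinementDefs
import Summits.CriticalPhenomena.CardyFormulaZ2.Theorems.CardySelfRefinementGradientComparabilityStubSlopeBoundsCornerTransferReroute
import HarnessLib

/-!
# Crux `GradientComparability` (stmt-CriticalPhenomena-10269), line `monotone-product-coordinates` —
# stub `stub_cornerLocalSlope` (LOC), corner transfer (B″₃), deterministic part: a pivotal edge
# hanging off a DEAD CLUSTER is impossible — the open cluster behind a pivotal edge escapes

Route `CardySelfRefinement`, sub-problem `CriticalPhenomena/CardyFormulaZ2`; vocabulary from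
`CardySelfRefinementDefs` (`Aloc window`); the closure-semantics kit of
`…StubNonAxialShareBulk{Topology,Reroute}` (`crossing_reroute`, `crossing_of_subset_union_of_disjoint`,
`exists_vertex_of_mem_inter`, `ball_subset_interior_or_disjoint`, `dist_meshPoint_le`) and the
`configOf` dictionary `mem_configOf_iff_exists_isCrossing_openEdgeUnion`.

## Mathematics

The pointwise corner transfer for `k = 2` (`exists_setPivotal_side_of_isPivotal_two`) starts from the
pendant lemma: a pivotal spoke `{w, μ}` of a far cell has another OPEN spoke at the centre `w`
(`exists_adj_mem_of_isPivotal`), which attaches `w` to the boundary ring of the cell.  For `k = 3`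
the cell has four interior vertices and the open edge found at an end `x` of the pivotal interior
edge `e = {x, μ}` may lead to another interior vertex; what is needed is that the `(ω ∖ e)`-open
cluster of `x`, explored through the interior of the cell, ESCAPES (reaches the boundary ring or
`μ`).  This file proves the configuration-wise fact behind it, for every `k` and every quad family
(joint event, any `m`):

**Dead clusters are never behind a pivotal edge.**  Let `C` be a set of lattice points within
sup-distance `N` of `v ∈ C`, the drawn `v` at distance `≥ r ≥ (4N+4)η` from every side of every
quad, `a ∉ C` a neighbour of `v`, and suppose every open edge of `ω` with an end in `C` other than
`e = {a, v}` has both ends in `C` (`C` is DEAD: attached to the rest of `ω ∪ {e}` only through `e`).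
Then `ω ∪ {e} ∈ Aloc → ω ∖ {e} ∈ Aloc` (`sdiff_mem_Aloc_of_deadCluster`): with `R` = `e` and the
open edges touching `C`, the drawings of `ω ∖ R` and `R` meet at most at the drawn `a`, all of the
drawing of `R` lies in the `r`-ball about the drawn `v`, so for a quad containing the ball the
crossing is rerouted through the single point `a` (`crossing_reroute`), and a quad missing the ball
does not see `R` (`crossing_sdiff_deadCluster`; the pendant lemma `crossing_sdiff_pendant` is the
case `C = {v}`).  Contrapositive (`exists_adj_notMem_of_isPivotal`, registered): if `{a, v}` is
pivotal for `Aloc m F η` at `ω`, some open edge `{x, y} ≠ {a, v}` of `ω` leaves `C` (`x ∈ C`,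
`y ∉ C`).  Applied (by the `k = 3` worker) to `C` = the interior vertices of the cell reachable from
`x` by `(ω ∖ e)`-open interior edges (`N = 1`, `8η ≤ 20η ≤ r`), the exit `y` is a ring vertex: step
(1) of the `k = 3` chase; steps (2) `mem_Aloc_of_local_patch` and (3) `setPivotal_chain4` are
`k`-free.
-/

noncomputable section

namespace Summit.CriticalPhenomena.CardyFormulaZ2.Theorems.CardySelfRefinement

open scoped Topology
open Filter Set MeasureTheory
open Literature.Probability.LatticeModels Literature.Probability.Percolation
open Literature.Probability.Percolation.QuadCrossing
open Summit.CriticalPhenomena.CardyFormulaZ2.Theses.CardySelfRefinement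

/-! ## Removing an edge hanging off a dead cluster keeps a crossing (closure semantics) -/

/-- **Dead cluster, quad level.**  Let `v ∈ C`, `a ∉ C` adjacent to `v`, every point of `C` within
sup-distance `N` of `v`, the `r`-ball about the drawn `v` (`r > (2N+2)δ`) meeting no side of `Q`,
and every open edge of `ω` with an end in `C` other than `{a, v}` having both ends in `C`.  Then a
crossing of `Q` inside the drawing of `ω ∪ {av}` yields one inside the drawing of `ω ∖ {av}`
(indeed of `ω` minus all open edges touching `C`): the two drawings meet at most at the drawn `a`. -/
theorem crossing_sdiff_deadCluster {D : Set ℂ} {δ : ℝ} (hδ : 0 < δ) (Q : Quad D)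
    {ω : BondConfig (Site 2)} {C : Set (Site 2)} {a v : Site 2} (hav : (zdGraph 2).Adj a v)
    (hvC : v ∈ C) (haC : a ∉ C) {N : ℕ} (hCnear : ∀ x ∈ C, ∀ l, |x l - v l| ≤ (N : ℤ))
    (hdead : ∀ x ∈ C, ∀ y, (zdGraph 2).Adj x y → s(x, y) ∈ ω → y ∈ C ∨ s(x, y) = s(a, v))
    {r : ℝ} (hδr : (2 * N + 2) * δ < r) (hfar : ∀ j : Fin 4, ∀ p ∈ Q.side j, r ≤ dist (meshPoint δ v) p)
    (hcr : ∃ K, Q.IsCrossing K ∧ K ⊆ openEdgeUnion δ (insert s(a, v) ω)) :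
    ∃ K, Q.IsCrossing K ∧ K ⊆ openEdgeUnion δ (ω \ {s(a, v)}) := by
  -- the dead part `R` and the rest `ρ'`
  set R : BondConfig (Site 2) := {f | f ∈ insert s(a, v) ω ∧ ∃ x ∈ C, x ∈ f} with hR
  set ρ' : BondConfig (Site 2) := ω \ R with hρ'
  have heR : s(a, v) ∈ R := ⟨Set.mem_insert _ _, v, hvC, Sym2.mem_mk_right _ _⟩
  have hρ'sub : ρ' ⊆ ω \ {s(a, v)} := fun f hf => ⟨hf.1, fun h => hf.2 (h ▸ heR)⟩
  have hsub : insert s(a, v) ω ⊆ ρ' ∪ R := by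
    intro f hf
    by_cases h : f ∈ R
    · exact Or.inr h
    · refine Or.inl ⟨(Set.mem_insert_iff.1 hf).resolve_left (fun hfe => h (hfe ▸ heR)), h⟩
  have hST : ∀ f ∈ R, f ∉ ρ' := fun f hf hf' => hf'.2 hf
  suffices h : ∃ K, Q.IsCrossing K ∧ K ⊆ openEdgeUnion δ ρ' by
    obtain ⟨K, hK, hKO⟩ := h
    exact ⟨K, hK, hKO.trans (openEdgeUnion_mono δ hρ'sub)⟩
  -- every end of an edge of `R` is in `C` or adjacent to a point of `C`, hence drawn in the ball
  have hball_pt : ∀ x : Site 2, (x ∈ C ∨ ∃ x' ∈ C, (zdGraph 2).Adj x' x) →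
      dist (meshPoint δ x) (meshPoint δ v) < r := by
    intro x hx
    have hcoord : ∀ l, |((x l : ℤ) : ℝ) - v l| ≤ N + 1 := by
      intro l
      rcases hx with hxC | ⟨x', hx'C, hx'x⟩
      · have h := hCnear x hxC l
        have h' : |((x l : ℤ) : ℝ) - v l| ≤ N := by exact_mod_cast h
        linarith
      · have h := hCnear x' hx'C l
        have h' : |((x' l : ℤ) : ℝ) - v l| ≤ N := by exact_mod_cast h
        have h'' := adj_coord_sub_abs_le hx'x l
        calc |((x l : ℤ) : ℝ) - v l| = |(((x' l : ℤ) : ℝ) - v l) - (((x' l : ℤ) : ℝ) - x l)| := by ring_nf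
          _ ≤ |((x' l : ℤ) : ℝ) - v l| + |((x' l : ℤ) : ℝ) - x l| := abs_sub _ _
          _ ≤ N + 1 := by linarith
    calc dist (meshPoint δ x) (meshPoint δ v) ≤ δ * (|((x 0 : ℤ) : ℝ) - v 0| + |((x 1 : ℤ) : ℝ) - v 1|) :=
          dist_meshPoint_le hδ.le x v
      _ ≤ δ * ((N + 1) + (N + 1)) := by gcongr <;> exact hcoord _
      _ = (2 * N + 2) * δ := by ring
      _ < r := hδr
  have hRball : openEdgeUnion δ R ⊆ Metric.ball (meshPoint δ v) r := by
    refine openEdgeUnion_subset_of_forall fun x y hxy hxyR => ?_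
    obtain ⟨-, x', hx'C, hx'mem⟩ := hxyR
    have hx : x ∈ C ∨ ∃ x' ∈ C, (zdGraph 2).Adj x' x := by
      rcases Sym2.mem_iff.1 hx'mem with rfl | rfl
      exacts [Or.inl hx'C, Or.inr ⟨_, hx'C, hxy.symm⟩]
    have hy : y ∈ C ∨ ∃ x' ∈ C, (zdGraph 2).Adj x' y := by
      rcases Sym2.mem_iff.1 hx'mem with rfl | rfl
      exacts [Or.inr ⟨_, hx'C, hxy⟩, Or.inl hx'C]
    exact (convex_ball (meshPoint δ v) r).segment_subset (hball_pt x hx) (hball_pt y hy)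
  -- the drawings of `ρ'` and `R` meet at most at the drawn `a`
  have hmeet : ∀ z ∈ openEdgeUnion δ ρ', z ∈ openEdgeUnion δ R → z = meshPoint δ a := by
    intro z hzO hzR
    obtain ⟨x, rfl, ⟨y, hxy, hxyR⟩, ⟨y', -, hy'⟩⟩ := exists_vertex_of_mem_inter hδ hST hzR hzO
    have hxC : x ∉ C := fun hxC => hy'.2 ⟨Set.mem_insert_of_mem _ hy'.1, x, hxC, Sym2.mem_mk_left _ _⟩
    obtain ⟨hxyI, x', hx'C, hx'mem⟩ := hxyR
    have hyC : y ∈ C := by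
      rcases Sym2.mem_iff.1 hx'mem with rfl | rfl
      exacts [absurd hx'C hxC, hx'C]
    have hxa : s(x, y) = s(a, v) → meshPoint δ x = meshPoint δ a := fun h => by
      rcases eq_or_eq_of_sym2_eq h with rfl | rfl
      exacts [rfl, absurd hvC hxC]
    rcases Set.mem_insert_iff.1 hxyI with h | hω
    · exact hxa h
    · rcases hdead y hyC x hxy.symm (by rw [Sym2.eq_swap]; exact hω) with h | h
      · exact absurd h hxC
      · exact hxa (by rw [Sym2.eq_swap]; exact h)
  rcases ball_subset_interior_or_disjoint Q hfar with hin | hout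
  · refine crossing_reroute hδ Q hsub (P := {z | z = meshPoint δ a ∧ z ∈ openEdgeUnion δ ρ'}) ?_ ?_ ?_ ?_ ?_ ?_ hcr
    · exact (Set.subsingleton_of_forall_eq (meshPoint δ a) fun z hz => hz.1).isCompact
    · exact (Set.subsingleton_of_forall_eq (meshPoint δ a) fun z hz => hz.1).isPreconnected
    · rintro z ⟨rfl, -⟩
      exact interior_subset (hin (hball_pt a (Or.inr ⟨v, hvC, hav.symm⟩)))
    · exact fun z hz => hz.2
    · exact fun z hzO hzR => ⟨hmeet z hzO hzR, hzO⟩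
    · intro z hz
      have hzi : z ∈ interior Q.carrier := hin (hRball hz)
      exact ⟨notMem_side_of_mem_interior Q hzi 0, notMem_side_of_mem_interior Q hzi 2⟩
  · exact crossing_of_subset_union_of_disjoint δ Q hsub (fun z hz => hout z (hRball hz)) hcr

/-! ## The `Aloc` version and its contrapositive -/

/-- **Dead clusters are never behind a pivotal edge.**  Let `v ∈ C`, `a ∉ C` adjacent to `v`,
every point of `C` within sup-distance `N` of `v`, the drawn `v` at distance `≥ r ≥ (4N+4)η` from
every side of every quad of the family, and every open edge of `ω` with an end in `C` other than
`{a, v}` having both ends in `C`.  Then `ω ∪ {av} ∈ Aloc m F η → ω ∖ {av} ∈ Aloc m F η`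
(the pendant lemma `sdiff_mem_Aloc_of_pendant` is the case `C = {v}`). -/
theorem sdiff_mem_Aloc_of_deadCluster (m : ℕ) (F : Fin m → Quad (Set.univ : Set ℂ)) {η r : ℝ}
    (hη : 0 < η) {N : ℕ} (hNr : (4 * N + 4) * η ≤ r) {ω : BondConfig (Site 2)} {C : Set (Site 2)}
    {a v : Site 2} (hav : (zdGraph 2).Adj a v) (hvC : v ∈ C) (haC : a ∉ C)
    (hCnear : ∀ x ∈ C, ∀ l, |x l - v l| ≤ (N : ℤ))
    (hdead : ∀ x ∈ C, ∀ y, (zdGraph 2).Adj x y → s(x, y) ∈ ω → y ∈ C ∨ s(x, y) = s(a, v))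
    (hfar : ∀ (i : Fin m) (j : Fin 4), ∀ p ∈ (F i).side j,
      r ≤ dist ((η : ℂ) * squareLatticeEmbedding.z v) p)
    (hin : insert s(a, v) ω ∈ Aloc m F η) : ω \ {s(a, v)} ∈ Aloc m F η := by
  -- adapted from `sdiff_mem_Aloc_of_pendant` (…StubSlopeBoundsCornerPendant)
  set W : Set (Sym2 (Site 2)) := window m F η with hW_def
  have hW : W ⊆ (zdGraph 2).edgeSet := Set.iUnion_subset fun i => Set.inter_subset_right
  set dd : ℝ := η * Real.sqrt 2 with hdd_def
  have hdd : 0 < dd := by positivity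
  have hsqrt : Real.sqrt 2 < 3 / 2 := (Real.sqrt_lt' (by norm_num)).2 (by norm_num)
  have hddr : (2 * N + 2) * dd < r := by
    have hN : (0 : ℝ) ≤ N := N.cast_nonneg
    have h1 : dd < 3 / 2 * η := by rw [hdd_def]; nlinarith
    have h2 : (2 * (N : ℝ) + 2) * dd < (2 * N + 2) * (3 / 2 * η) := mul_lt_mul_of_pos_left h1 (by positivity)
    nlinarith
  have hz : (η : ℂ) * squareLatticeEmbedding.z v = meshPoint dd v := by
    simp only [squareLatticeEmbedding, meshPoint, Complex.ofReal_mul, mul_assoc, hdd_def]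
  have he : s(a, v) ∈ (zdGraph 2).edgeSet := (SimpleGraph.mem_edgeSet _).2 hav
  have h1 : insert s(a, v) ω ∩ W ⊆ insert s(a, v) (ω ∩ W) := by
    rintro e ⟨he, heW⟩
    rcases Set.mem_insert_iff.1 he with rfl | heω
    · exact Set.mem_insert _ _
    · exact Set.mem_insert_of_mem _ ⟨heω, heW⟩
  have h2 : (ω ∩ W) \ {s(a, v)} ⊆ ω \ {s(a, v)} ∩ W := by
    rintro e ⟨⟨heω, heW⟩, hne⟩
    exact ⟨⟨heω, hne⟩, heW⟩
  have hdead' : ∀ x ∈ C, ∀ y, (zdGraph 2).Adj x y → s(x, y) ∈ ω ∩ W → y ∈ C ∨ s(x, y) = s(a, v) :=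
    fun x hx y hxy hω => hdead x hx y hxy hω.1
  intro i
  have hi : F i ∈ configOf squareLatticeEmbedding.z η Set.univ (insert s(a, v) ω ∩ W) := hin i
  rw [mem_configOf_iff_exists_isCrossing_openEdgeUnion hη (Set.inter_subset_right.trans hW)] at hi
  show F i ∈ configOf squareLatticeEmbedding.z η Set.univ (ω \ {s(a, v)} ∩ W)
  rw [mem_configOf_iff_exists_isCrossing_openEdgeUnion hη (Set.inter_subset_right.trans hW)]
  obtain ⟨K, hK, hKO⟩ := hi
  have hcr : ∃ K, (F i).IsCrossing K ∧ K ⊆ openEdgeUnion dd (insert s(a, v) (ω ∩ W)) :=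
    ⟨K, hK, hKO.trans (openEdgeUnion_mono dd h1)⟩
  obtain ⟨K', hK', hK'O⟩ := crossing_sdiff_deadCluster hdd (F i) hav hvC haC hCnear hdead' hddr
    (fun j p hp => hz ▸ hfar i j p hp) hcr
  exact ⟨K', hK', hK'O.trans (openEdgeUnion_mono dd h2)⟩

/-- **The open cluster behind a pivotal edge escapes** (registered helper of `stub_cornerLocalSlope`;
step (1) of the pointwise corner transfer for `k = 3`).  Let `v ∈ C`, `a ∉ C` adjacent to `v`, every
point of `C` within sup-distance `N` of `v`, and the drawn `v` at distance `≥ r ≥ (4N+4)η` from every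
side of every quad.  If `{a, v}` is pivotal for the localised joint crossing event `Aloc m F η` at
`ω`, then some OPEN edge `{x, y} ≠ {a, v}` of `ω` leaves `C`: `x ∈ C`, `y ∉ C`.  (For `C = {v}` this
is `exists_adj_mem_of_isPivotal`; for `C` = the interior vertices of a `k = 3` cell reachable from
`v` by open interior edges, the exit is a boundary vertex of the cell.) -/
theorem exists_adj_notMem_of_isPivotal : ∀ (m : ℕ) (F : Fin m → Quad (Set.univ : Set ℂ)) (η r : ℝ), 0 < η → ∀ (N : ℕ), (4 * (N : ℝ) + 4) * η ≤ r → ∀ (ω : BondConfig (Site 2)) (C : Set (Site 2)) (a v : Site 2), (zdGraph 2).Adj a v → v ∈ C → a ∉ C → (∀ x ∈ C, ∀ l, |x l - v l| ≤ (N : ℤ)) → (∀ (i : Fin m) (j : Fin 4), ∀ p ∈ (F i).side j, r ≤ dist ((η : ℂ) * squareLatticeEmbedding.z v) p) → IsPivotal (Aloc m F η) s(a, v) ω → ∃ x ∈ C, ∃ y ∉ C, (zdGraph 2).Adj x y ∧ s(x, y) ∈ ω ∧ s(x, y) ≠ s(a, v) := by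
  intro m F η r hη N hNr ω C a v hav hvC haC hCnear hfar hpiv
  by_contra hno
  push Not at hno
  have hdead : ∀ x ∈ C, ∀ y, (zdGraph 2).Adj x y → s(x, y) ∈ ω → y ∈ C ∨ s(x, y) = s(a, v) := by
    intro x hx y hxy hω
    by_cases hy : y ∈ C
    · exact Or.inl hy
    · exact Or.inr (hno x hx y hy hxy hω)
  have h1 : insert s(a, v) ω ∈ Aloc m F η ∧ ω \ {s(a, v)} ∉ Aloc m F η := by
    rcases hpiv with ⟨ha, hb⟩ | ⟨ha, hb⟩
    · exact ⟨ha, hb⟩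
    · exact absurd (isUpperSet_Aloc m F η (Set.sdiff_subset.trans (Set.subset_insert _ ω)) ha) hb
  exact h1.2 (sdiff_mem_Aloc_of_deadCluster m F hη hNr hav hvC haC hCnear hdead hfar h1.1)

end Summit.CriticalPhenomena.CardyFormulaZ2.Theorems.CardySelfRefinement

end
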